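import Literature.AlgebraicGeometry.HodgeTheory.IntegralLefschetzOneOne
import Literature.AlgebraicGeometry.HodgeTheory.ComplexConjugationHolds

/-!
# Torsion classes in `H²(X(ℂ); ℤ)` die on a non-empty Zariski open

For `X` smooth projective over `ℂ`, a torsion class `z ∈ H²(X(ℂ); ℤ)` restricts to `0` in
`H²((X ∖ Z)(ℂ); ℤ)` for some Zariski-closed `Z ≠ X`: its complexification vanishes, so is of Hodge
type `(1,1)` (a Hodge model exists, `nonempty_hodgeModel_holds`), and the integral Lefschetz theorem
on `(1,1)`-classes in Zariski-local form (`integralLefschetzOneOne`: Voisin I, Thm. 11.30 with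
Remark 7.9 — torsion classes are first Chern classes of holomorphic, hence algebraic, line bundles —
and Thm. 11.33) kills it off a divisor.  This is the degree-`2`, `Z = ∅` instance of "torsion dies
generically" (Colliot-Thélène–Voisin 2012, Thm. 3.1, there for all degrees via Bloch–Kato), obtained
here Hodge-theoretically and unconditionally.

* `torsionClass_two_map_eq_zero` — the statement above.

References: C. Voisin, *Hodge Theory and Complex Algebraic Geometry I* (2002), Thm. 11.30, Rem. 7.9,
Thm. 11.33 [VoisinHodgeI2002]; J.-L. Colliot-Thélène, C. Voisin, *Cohomologie non ramifiée et
conjecture de Hodge entière*, Duke Math. J. 161 (2012), Thm. 3.1 [ColliotTheleneVoisin2012].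
-/

noncomputable section

open Literature.AlgebraicTopology.SingularHomology

namespace Literature.AlgebraicGeometry.HodgeTheory

variable {n : ℕ} {X : Motives.SchemeOver ℂ}

/-- **Torsion classes in `H²(X(ℂ); ℤ)` die on a non-empty Zariski open.** For `X` smooth projective
over `ℂ` and `z ∈ H²(X(ℂ); ℤ)` with `N • z = 0` for some `N ≥ 1`, there is a Zariski-closed `Z ≠ X`
with `z|_{(X ∖ Z)(ℂ)} = 0` in integral cohomology: `z ⊗ ℂ = 0` is of type `(1,1)`, and the integral
Lefschetz theorem on `(1,1)`-classes applies. [cite: VoisinHodgeI2002, Thm. 11.30, Rem. 7.9, Thm. 11.33]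
[cite: ColliotTheleneVoisin2012, Thm 3.1] -/
theorem torsionClass_two_map_eq_zero (hX : Motives.IsSmoothProjective n X)
    (z : singularCohomology ℤ ℤ (Motives.ComplexPoints X) 2) {N : ℕ} (hN : 1 ≤ N) (hz : N • z = 0) :
    ∃ Z : Set X.left, IsClosed Z ∧ Z ≠ Set.univ ∧
      singularCohomology.map ℤ ℤ
        (⟨Subtype.val, continuous_subtype_val⟩ :
          C(Motives.complexPointsCompl X Z, Motives.ComplexPoints X)) 2 z = 0 := by
  obtain ⟨A⟩ := nonempty_hodgeModel_holds (n := n) (X := X) hX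
  refine integralLefschetzOneOne hX z ?_
  have h0 : singularCohomology.ringChange (Int.castRingHom ℂ) (Motives.ComplexPoints X) 2 z = 0 := by
    have h := congrArg (singularCohomology.ringChange (Int.castRingHom ℂ) (Motives.ComplexPoints X) 2) hz
    rw [map_nsmul, map_zero, ← Nat.cast_smul_eq_nsmul ℂ, smul_eq_zero] at h
    exact h.resolve_left (Nat.cast_ne_zero.2 (by omega))
  rw [h0]
  exact IsOfHodgeType.zero A 2 1 1

end Literature.AlgebraicGeometry.HodgeTheory
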